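import Literature.AlgebraicGeometry.Resolution.ArithmeticalThreefoldsLocalNormalTower
import Literature.AlgebraicGeometry.Resolution.KrullRamificationGroups
import Literature.AlgebraicGeometry.Resolution.AbelianPrimeGaloisTower
import HarnessLib

/-!
# Cossart–Piltant's climb above the ramification field: `(LU v₀ʳ) ⇒ (LU vʳ)`

Topic: `Literature/AlgebraicGeometry/Resolution`. PROOF side of `CossartPiltant2019ReductionP`
(`ArithmeticalThreefoldsLocal.lean`), continued from `ArithmeticalThreefoldsLocalNormalTower.lean`
(climbing data ascend finite towers of normal extensions of degree `p`) and
`KrullRamificationGroups.lean` (Zariski–Samuel VI §12: the large ramification group `G_V` of a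
valuation in a finite Galois extension is a `p`-group, Thm. 24, of index prime to `p` in the
inertia group `G_T`). In the proof of journal Prop. 4.10 (arXiv v1 Prop. 4.8, p. 54):

> consider the respective inertia and ramification fields `F ⊆ Fⁱ ⊆ Fʳ` of `v̄` … `Fⁱ|F` is
> unramified, `Fʳ|Fⁱ` is an Abelian extension of order prime to `p` which is totally ramified
> and `Kʳ|Fʳ` is a tower of totally ramified Galois extensions of degree `p` … Theorem 1.5 (ii)
> states that `(LU vʳ)` holds.

Here, for a finite Galois `N | M` inside the ambient valued field `(Ω, O_Ω)` (in the source: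
`N = K̄` a Galois closure of `K|F`, `M = F`), the RAMIFICATION FIELD is the fixed field of
`G_V = ramificationGroupIn O_Ω N` and the INERTIA FIELD that of `G_T = inertiaGroupIn O_Ω N`:

* `fixedField_inertiaGroupIn_le` — `Fⁱ ≤ Fʳ`.
* `relfinrank_ramificationField_eq_card`, `coprime_relfinrank_inertiaField_ramificationField`
  — `[N : Fʳ] = |G_V|` (a power of `p`) and `[Fʳ : Fⁱ] = (G_T : G_V)` is prime to `p`
  ("`Fʳ|Fⁱ` … of order prime to `p`").
* `isPrimeGaloisTower_inertiaField_ramificationField` — **`Fʳ | Fⁱ` is a tower of Galois extensions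
  of prime degrees `ℓ ≠ p`** ([CoP1] (8): "abelian of order prime to `p` … a tower of abelian
  extensions of prime degrees `l_i ≠ p`"): `G_T/G_V` is abelian (`commutator_mem_ramificationGroupIn`)
  of order prime to `p` (`coprime_index_ramificationGroupIn`), so `isPrimeGaloisTower_fixedField`
  (`AbelianPrimeGaloisTower.lean`) applies.
* `CossartPiltant2019Local.exists_model_of_ramificationField_le` — **`(LU v₀ʳ) ⇒ (LU v′)` for
  every field `K′` between `Fʳ` and `N`** (in particular `Kʳ = K·Fʳ`): `N | Fʳ` is Galois with
  Galois group the `p`-group `G_V`, so `CossartPiltant2019Local.exists_model_intermediateField_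
  of_isGalois_of_isPGroup` (the Artin–Schreier/Kummer steps of Thm. 1.5 (ii)) applies after
  rebasing to `Fʳ` (`TameTowerRebase.lean`).

What remains of the source's chain `(LU v₀) ⇒ (LU v₀ⁱ) ⇒ (LU v₀ʳ) ⇒ (LU vʳ) ⇒ (LU vⁱ) ⇒ (LU v)`
after this file: the unramified ascent `F → Fⁱ` ([CoP1] Cor. 7.3 with Galois approximation
Thm. 7.2), the tame ascent `Fⁱ → Fʳ` ([CoP1] Prop. 6.3, Perron), and the descents
`Kʳ → Kⁱ → K` ([CoP1] Props. 9.1, 9.3) — not treated here.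

Everything is PROVED; no named facts are introduced (the local theorem enters as the hypothesis
`hloc : CossartPiltant2019Local`).

## Sources

* V. Cossart, O. Piltant, J. Algebra 529 (2019) 268–535 = arXiv:1412.0868: proof of Prop. 4.10
  (arXiv v1: Prop. 4.8, p. 54). [CossartPiltant2019]
* O. Zariski, P. Samuel, *Commutative Algebra* II (1960), Ch. VI §12. [ZariskiSamuel1960]
-/

noncomputable section

open IsLocalRing Polynomial IntermediateField Module

namespace Literature.AlgebraicGeometry.Resolution

universe u

section Fields

variable {Ω : Type u} [Field Ω] (V : ValuationSubring Ω) {M : Subfield Ω}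
  (N : IntermediateField M Ω)

/-- `Fⁱ ≤ Fʳ`: the inertia field lies in the ramification field (`G_V ≤ G_T`).
[cite: ZariskiSamuel1960, Ch. VI §12, p. 75] -/
theorem fixedField_inertiaGroupIn_le :
    fixedField (inertiaGroupIn V N) ≤ fixedField (ramificationGroupIn V N) := by
  intro x hx
  rw [IntermediateField.mem_fixedField_iff] at hx ⊢
  exact fun σ hσ => hx σ (ramificationGroupIn_le_inertiaGroupIn V N hσ)

variable [FiniteDimensional M N]

/-- `[N : Fʳ] = |G_V|` and `[N : Fⁱ] = |G_T|` (Artin), as relative degrees of subfields of `Ω`.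
[cite: ZariskiSamuel1960, Ch. VI §12, Thm. 25 Cor., p. 78] -/
theorem relfinrank_fixedField_eq_card (H : Subgroup (N ≃ₐ[M] N)) :
    Subfield.relfinrank (lift (fixedField H)).toSubfield N.toSubfield = Nat.card H := by
  rw [Subfield.relfinrank_eq_finrank_of_le (lift_toSubfield_le (fixedField H)),
    finrank_extendScalars_lift, IntermediateField.finrank_fixedField_eq_card]

/-- **`[Fʳ : Fⁱ] = (G_T : G_V)` is prime to the residue characteristic `p`** ("`Fʳ|Fⁱ` is an
Abelian extension of order prime to `p`"; Zariski–Samuel VI §12 (23)).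
[cite: ZariskiSamuel1960, Ch. VI §12 (23), p. 76] -/
theorem coprime_relfinrank_inertiaField_ramificationField {p : ℕ} [Fact p.Prime]
    [CharP (ResidueField V) p] :
    p.Coprime (Subfield.relfinrank (lift (fixedField (inertiaGroupIn V N))).toSubfield
      (lift (fixedField (ramificationGroupIn V N))).toSubfield) := by
  have hle : (lift (fixedField (inertiaGroupIn V N))).toSubfield ≤
      (lift (fixedField (ramificationGroupIn V N))).toSubfield := by
    intro x hx
    have hx' := (mem_lift ⟨x, lift_le _ hx⟩).mp hx
    exact (mem_lift ⟨x, lift_le _ hx⟩).mpr (fixedField_inertiaGroupIn_le V N hx')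
  have hmul := Subfield.relfinrank_mul_relfinrank hle
    (lift_toSubfield_le (fixedField (ramificationGroupIn V N)))
  rw [relfinrank_fixedField_eq_card, relfinrank_fixedField_eq_card] at hmul
  -- `|G_T| = |G_V| · (G_T : G_V)`
  have hindex := Subgroup.card_mul_index
    ((ramificationGroupIn V N).subgroupOf (inertiaGroupIn V N))
  rw [Nat.card_congr (Subgroup.subgroupOfEquivOfLe
    (ramificationGroupIn_le_inertiaGroupIn V N)).toEquiv] at hindex
  rw [← hindex, mul_comm] at hmul
  have hpos : 0 < Nat.card (ramificationGroupIn V N) := Nat.card_pos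
  rw [Nat.eq_of_mul_eq_mul_left hpos hmul]
  exact coprime_index_ramificationGroupIn V N

/-- `[N : Fʳ]` is a power of `p` (Thm. 24). [cite: ZariskiSamuel1960, Ch. VI §12, Thm. 24, p. 77] -/
theorem exists_relfinrank_ramificationField_eq_pow {p : ℕ} [Fact p.Prime]
    [CharP (ResidueField V) p] :
    ∃ k : ℕ, Subfield.relfinrank (lift (fixedField (ramificationGroupIn V N))).toSubfield
      N.toSubfield = p ^ k := by
  rw [relfinrank_fixedField_eq_card]
  exact (isPGroup_ramificationGroupIn V N).exists_card_eq

/-- **`Fʳ | Fⁱ` is a tower of Galois extensions of prime degrees `ℓ ≠ p`** (Cossart–Piltant 2019,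
proof of Prop. 4.10, arXiv v1 p. 54: "`Fʳ|Fⁱ` is an Abelian extension of order prime to `p`";
[CoP1] (8), proof of Thm. 7.2 = journal Thm. 8.1: "a tower of abelian extensions of prime degrees
`l_i ≠ p`"): `G_V ≤ G_T` contains all commutators of `G_T` and has index prime to `p`
(Zariski–Samuel VI §12 (23)), so the group-theoretic refinement of `AbelianPrimeGaloisTower.lean`
applies, for `N | M` finite Galois inside `Ω`.
[cite: CossartPiltant2019, proof of Prop. 4.10 (arXiv v1: Prop. 4.8, p. 54)] -/
theorem isPrimeGaloisTower_inertiaField_ramificationField {p : ℕ} [Fact p.Prime]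
    [CharP (ResidueField V) p] [IsGalois M N] :
    IsPrimeGaloisTower p (lift (fixedField (inertiaGroupIn V N))).toSubfield
      (lift (fixedField (ramificationGroupIn V N))).toSubfield :=
  isPrimeGaloisTower_fixedField p _ (inertiaGroupIn V N) (ramificationGroupIn V N)
    (ramificationGroupIn_le_inertiaGroupIn V N)
    (fun _ hs _ ht => commutator_mem_ramificationGroupIn V N hs ht)
    ((Nat.Prime.coprime_iff_not_dvd Fact.out).mp (coprime_index_ramificationGroupIn V N)) rfl

end Fields

/-! ## The climb above the ramification field -/

section Climb

variable {S Ω : Type u} [CommRing S] [IsDomain S] [IsLocalRing S] [Field Ω] [Algebra S Ω]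
  (OΩ : ValuationSubring Ω)

/-- **`(LU v₀ʳ) ⇒ (LU v′)` for every field between the ramification field and the top of a
finite Galois extension** (Cossart–Piltant 2019, proof of Prop. 4.10, arXiv v1 p. 54:
"`Kʳ|Fʳ` is a tower of totally ramified Galois extensions of degree `p` … Theorem 1.5 (ii)
states that `(LU vʳ)` holds"; the ramification group is a `p`-group, Zariski–Samuel VI §12
Thm. 24). Setting: `S` excellent regular local of dimension three and residue characteristic
`p` inside the ambient valued field `(Ω, O_Ω)` dominating it, with `char(O_Ω/𝔪) = p`;
`N | M` finite Galois inside `Ω` with `S ⊆ M`; `Fʳ = N^{G_V}` the ramification field of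
`O_Ω ∩ N`; `K′` an intermediate field containing `Fʳ`; in characteristic `p`, or in
characteristic `0` with `ζ_p ∈ N`. Then climbing data at `Fʳ` (a model `S[t] ⊆ O_Ω`,
`t ⊆ Fʳ ⊆ Frac(S)(t)`, regular at the centre) yield climbing data at `K′`: `N | Fʳ` is Galois
with Galois group `G_V`, a `p`-group, and
`CossartPiltant2019Local.exists_model_intermediateField_of_isGalois_of_isPGroup` applies after
rebasing to `Fʳ`.
[cite: CossartPiltant2019, proof of Prop. 4.10 (arXiv v1: Prop. 4.8, p. 54) with Thm. 1.5 (ii)] -/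
theorem CossartPiltant2019Local.exists_model_of_ramificationField_le
    (hloc : CossartPiltant2019Local.{u}) (p : ℕ) [hp : Fact p.Prime] [Algebra.IsAlgebraic S Ω]
    (hinj : Function.Injective (algebraMap S Ω))
    (hS : IsExcellentRing S) (hSdim : ringKrullDim S = 3) (hSchar : CharP (ResidueField S) p)
    (hSO : ∀ s : S, algebraMap S Ω s ∈ OΩ)
    (hdom : ∀ s ∈ maximalIdeal S, OΩ.valuation (algebraMap S Ω s) < 1)
    (hres : ∀ y : OΩ, ∃ q : S[X], (∃ i, q.coeff i ∉ maximalIdeal S) ∧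
      OΩ.valuation (q.eval₂ (algebraMap S Ω) y) < 1)
    [CharP (ResidueField OΩ) p]
    (M : Subfield Ω) (hSM : ∀ s : S, algebraMap S Ω s ∈ M)
    (N : IntermediateField M Ω) [FiniteDimensional M N] [IsGalois M N]
    (K : IntermediateField M N) (hK : fixedField (ramificationGroupIn OΩ N) ≤ K)
    (hchar : CharP Ω p ∨ (CharZero Ω ∧ ∃ ζ ∈ N, IsPrimitiveRoot ζ p))
    (hINV : ∃ t : Finset Ω,
      (t : Set Ω) ⊆ (lift (fixedField (ramificationGroupIn OΩ N))).toSubfield ∧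
      (lift (fixedField (ramificationGroupIn OΩ N))).toSubfield ≤
        Subfield.closure (Set.range (algebraMap S Ω) ∪ (t : Set Ω)) ∧
      ∃ hTO : (Algebra.adjoin S (t : Set Ω)).toSubring ≤ OΩ.toSubring,
        IsRegularLocalRing (Localization.AtPrime
          (Ideal.comap (Subring.inclusion hTO) (maximalIdeal OΩ)))) :
    ∃ t : Finset Ω, (t : Set Ω) ⊆ (lift K).toSubfield ∧
      (lift K).toSubfield ≤ Subfield.closure (Set.range (algebraMap S Ω) ∪ (t : Set Ω)) ∧
      ∃ hTO : (Algebra.adjoin S (t : Set Ω)).toSubring ≤ OΩ.toSubring,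
        IsRegularLocalRing (Localization.AtPrime
          (Ideal.comap (Subring.inclusion hTO) (maximalIdeal OΩ))) := by
  haveI := finiteDimensional_extendScalars_lift (fixedField (ramificationGroupIn OΩ N))
  haveI := isGalois_extendScalars_lift (fixedField (ramificationGroupIn OΩ N))
  have hG : IsPGroup p
      (Subfield.extendScalars (lift_toSubfield_le (fixedField (ramificationGroupIn OΩ N)))
        ≃ₐ[(lift (fixedField (ramificationGroupIn OΩ N))).toSubfield]
      Subfield.extendScalars (lift_toSubfield_le (fixedField (ramificationGroupIn OΩ N)))) := by
    refine isPGroup_extendScalars_lift (fixedField (ramificationGroupIn OΩ N)) ?_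
    rw [IntermediateField.fixingSubgroup_fixedField]
    exact isPGroup_ramificationGroupIn OΩ N
  obtain ⟨K', hK'⟩ := exists_rebase_intermediateField (fixedField (ramificationGroupIn OΩ N)) K hK
  have h := CossartPiltant2019Local.exists_model_intermediateField_of_isGalois_of_isPGroup OΩ hloc
    p hinj hS hSdim hSchar hSO hdom hres (lift (fixedField (ramificationGroupIn OΩ N))).toSubfield
    (fun s => le_lift_toSubfield _ (hSM s))
    (Subfield.extendScalars (lift_toSubfield_le (fixedField (ramificationGroupIn OΩ N)))) hG K'
    (hchar.imp_right fun ⟨h0, ζ, hζN, hζ⟩ => ⟨h0, ζ, (mem_extendScalars_lift_iff _ ζ).mpr hζN, hζ⟩)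
    hINV
  rwa [hK'] at h

end Climb

end Literature.AlgebraicGeometry.Resolution

end
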